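import Summits.NavierStokesRegularity.FluidComputer.PalasekTowerHeredityWitnessWindow
import Summits.NavierStokesRegularity.FluidComputer.ForcedContinuationHolds

/-!
# REGISTER v2.3′: a run FROM THE SLICE `u(τ k)` under the window force IS a continuation — the exact-slice
# (`ε = 0`, forced) window form of heredity, every level, unconditional

Cell `ns-blowup`, seat `ns-blowup-ecbridge-4` (g5; GROUP C «BRIDGE SUPPORT»; stub `first_episode` of the crux
`EpisodeBase` = `EpisodeBaseG`, item stmt-NavierStokesRegularity-19179, supports only). Sequel of ecbridge-6's
`PalasekTowerHeredityWitnessWindow.lean` (the `ε`-OVERLAP window form `Stage.exists_extends_of_window_solution`: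
restart from the stage's state at `τ k − ε`, `ε > 0`, the stage being the bounded competitor on the overlap)
and of `ns-palasek-19249-p2`'s `PalasekTowerRegisterGlobalFloorsAtSlice.lean` (`Stage.exists_continuation_of_freeRun`:
exact-slice restart at levels `k ≥ 1` of a QUIET schedule, where the force is silent and the run unforced).
Companion (wide rates, `k = 0`, the first episode by the singleton class):
`PalasekTowerRegisterGlobalExactSliceEpisode.lean`. LABEL: E–C typing (KERNEL plumbing: theorems only, no
definition, no named fact). WHAT THIS IS NOT: not Navier–Stokes evidence — no stage, host, flow or tower is
constructed; `Schedule.LevelWitness` / a stage one level up appear only as conclusions of conditionals whose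
hypothesis is a classical run nobody has exhibited.

* §1 `Stage.exists_continuation_of_windowRun` — ANY level `k`, ANY rates / schedule / margin, `ν > 0`, FORCED
  window: a classical solution `(w, r)` on `[0, W]` of the system forced by the TRANSLATED design force
  `σ ↦ S.f (σ + τ k)`, starting AT the slice `w 0 = s.u (τ k)`, of finite energy and bounded, IS the translate
  of a classical finite-energy continuation of the stage to `[0, τ k + W]` (velocity AND pressure agree with
  the stage on `[0, τ k]`). Ingredients, all landed: the unconditional local continuation of every stage past
  its slab (`Stage.exists_continuation_past`, F2 = Tao 2013 Thm 5.4 with force,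
  `tao2011_smooth_local_existence_forced_holds`), bounded-classical uniqueness on the overlap
  (`velocity_eq_of_bounded_classical_Icc`, forced Serrin–Masuda, no W14), pressure re-gauging
  (`IsClassicalNSSolutionOn.exists_pressure_eq_on_Icc`), gluing (`IsClassicalNSSolutionOn.glue_Icc`).
  Absolute-time corollary `Stage.exists_continuation_of_sliceRun` (run `(v, q)` on `[τ k, T]` under `S.f`,
  `v (τ k) = s.u (τ k)`). This removes both the `ε > 0` of the window form and the `k ≥ 1 ∧ Quiet` of the
  free-run form: the restart is AT the readout, under the force acting on the window.
* §2 `Stage.levelWitness_of_sliceRun`, `Stage.exists_extends_of_sliceRun` — with the next ceiling on the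
  window and the three floors at `τ (k+1)` the glued continuation is a level witness (`Schedule.LevelWitness`),
  hence, for the route margin, a registered stage one level up extending `s`
  (`Stage.nonempty_extends_of_levelWitness'`); converse `Stage.Extends.sliceRun`.

References: S. Palasek, arXiv:2605.13827 §4 [cite: Palasek2026ElementaryModel, §4]; H. Sohr, *The
Navier–Stokes Equations*, Birkhäuser 2001, Ch. V Thm. 1.5.1 [cite: Sohr2001, Ch. V Thm. 1.5.1]; T. Tao,
Anal. PDE 6 (2013), Thm. 5.4 [cite: Tao2011, Thm. 5.4 (ii)+(iv)].
-/

noncomputable section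

namespace Summit.NavierStokesRegularity.FluidComputer.PalasekTowerClayBridge

open Set MeasureTheory Filter Topology Function Real
open scoped ENNReal ContDiff NNReal
open Literature.Analysis.FluidPDE

/-! ## §1 A run from the slice under the window force IS a continuation (every level, unconditional) -/

namespace Stage

variable {ν : ℝ} {R : TowerRates} {S : Schedule R} {m : Margins R} {k : ℕ}

/-- **A forced window run from the slice is the translate of a continuation** (any level `k`, any rates,
schedule and margin, `ν > 0`; no quietness, no `ε`-overlap). Let `s` be a stage at level `k` and `(w, r)`
a classical solution on `[0, W]`, `W > 0`, of the Navier–Stokes system forced by the translated design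
force `σ ↦ S.f (σ + τ k)`, starting at the slice `w 0 = s.u (τ k)`, of finite energy and bounded. Then
there is a classical finite-energy continuation `(u, p)` of `s` on `[0, τ k + W]` under `S.f`, agreeing
with `s` in velocity and pressure on `[0, τ k]`, with `u (σ + τ k) = w σ` on `[0, W]`. Proof: the stage
continues classically past `τ k` (`Stage.exists_continuation_past`); on the overlap the translate of `w`
is the bounded competitor, so the two coincide (`velocity_eq_of_bounded_classical_Icc`); the pressure of
`w` is re-gauged to the continuation's on the overlap (`exists_pressure_eq_on_Icc`); glue (`glue_Icc`).
[cite: Sohr2001, Ch. V Thm. 1.5.1] [cite: Tao2011, Thm. 5.4 (ii)+(iv)] -/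
theorem exists_continuation_of_windowRun (hν : 0 < ν) (s : Stage ν R S m k) {W : ℝ} (hW : 0 < W)
    {w : ℝ → EuclideanSpace ℝ (Fin 3) → EuclideanSpace ℝ (Fin 3)} {r : ℝ → EuclideanSpace ℝ (Fin 3) → ℝ}
    (hw : IsClassicalNSSolutionOn (Icc 0 W) ν (fun σ => S.f (σ + S.τ k)) w r)
    (hw0 : w 0 = s.u (S.τ k))
    (hEw : ∃ C : ℝ≥0∞, C < ⊤ ∧ ∀ σ ∈ Icc 0 W, ∫⁻ x, ‖w σ x‖ₑ ^ 2 ≤ C)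
    {B : ℝ} (hwB : ∀ σ ∈ Icc 0 W, ∀ x, ‖w σ x‖ ≤ B) :
    ∃ (u : ℝ → EuclideanSpace ℝ (Fin 3) → EuclideanSpace ℝ (Fin 3)) (p : ℝ → EuclideanSpace ℝ (Fin 3) → ℝ),
      IsClassicalNSSolutionOn (Icc 0 (S.τ k + W)) ν S.f u p ∧
      (∀ t ∈ Icc 0 (S.τ k), u t = s.u t ∧ p t = s.p t) ∧
      (∃ C : ℝ≥0∞, C < ⊤ ∧ ∀ t ∈ Icc 0 (S.τ k + W), ∫⁻ x, ‖u t x‖ₑ ^ 2 ≤ C) ∧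
      ∀ σ ∈ Icc 0 W, u (σ + S.τ k) = w σ := by
  obtain ⟨T₁, hT₁, u₁, p₁, h₁, h₁s, hE₁⟩ := s.exists_continuation_past hν
  set τk : ℝ := S.τ k with hτk
  have hτk0 : 0 ≤ τk := (S.τ_pos k).le
  -- the overlap length
  set δ : ℝ := min (T₁ - τk) W with hδdef
  have hδ : 0 < δ := lt_min (by linarith) hW
  have hδW : δ ≤ W := min_le_right _ _
  have hδT : τk + δ ≤ T₁ := by have := min_le_left (T₁ - τk) W; linarith
  -- the local continuation restricted to `[0, τ k + δ]`
  have hsub₁ : Icc 0 (τk + δ) ⊆ Icc 0 T₁ := Icc_subset_Icc_right hδT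
  have h₁' : IsClassicalNSSolutionOn (Icc 0 (τk + δ)) ν S.f u₁ p₁ :=
    h₁.mono hsub₁ (uniqueDiffOn_Icc (by linarith))
  have hE₁' : ∃ C : ℝ≥0∞, C < ⊤ ∧ ∀ t ∈ Icc 0 (τk + δ), ∫⁻ x, ‖u₁ t x‖ₑ ^ 2 ≤ C := by
    obtain ⟨C, hC, hb⟩ := hE₁
    exact ⟨C, hC, fun t ht => hb t (hsub₁ ht)⟩
  -- (1) the run translated back to absolute time solves the design's system on `[τ k, τ k + W]`
  have hpreb : Icc τk (τk + W) ⊆ (fun t => t + -τk) ⁻¹' Icc 0 W := by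
    intro t ht
    simp only [mem_preimage, mem_Icc] at ht ⊢
    constructor <;> linarith [ht.1, ht.2]
  have hwb0 : IsClassicalNSSolutionOn (Icc τk (τk + W)) ν
      (fun t => (fun σ => S.f (σ + S.τ k)) (t + -τk)) (fun t => w (t + -τk)) (fun t => r (t + -τk)) :=
    (hw.comp_add_right (-τk)).mono hpreb (uniqueDiffOn_Icc (by linarith))
  have hwbf : IsClassicalNSSolutionOn (Icc τk (τk + W)) ν S.f (fun t => w (t + -τk))
      (fun t => r (t + -τk)) :=
    hwb0.congr_force fun t _ x => by simp only [hτk, neg_add_cancel_right]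
  have hwbo : IsClassicalNSSolutionOn (Icc τk (τk + δ)) ν S.f (fun t => w (t + -τk))
      (fun t => r (t + -τk)) :=
    hwbf.mono (Icc_subset_Icc_right (by linarith)) (uniqueDiffOn_Icc (by linarith))
  -- (2) uniqueness on the overlap `[τ k, τ k + δ]`: `u₁ = w (· − τ k)` (`w` is the bounded competitor)
  have hsubo : Icc τk (τk + δ) ⊆ Icc 0 T₁ := fun t ht => ⟨hτk0.trans ht.1, ht.2.trans hδT⟩
  have h₁o : IsClassicalNSSolutionOn (Icc τk (τk + δ)) ν S.f u₁ p₁ :=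
    h₁.mono hsubo (uniqueDiffOn_Icc (by linarith))
  have hEwb : ∃ C : ℝ≥0∞, C < ⊤ ∧ ∀ t ∈ Icc τk (τk + δ), ∫⁻ x, ‖w (t + -τk) x‖ₑ ^ 2 ≤ C := by
    obtain ⟨C, hC, hb⟩ := hEw
    exact ⟨C, hC, fun t ht => hb (t + -τk) (hpreb ⟨ht.1, by linarith [ht.2]⟩)⟩
  have hBwb : ∀ t ∈ Icc τk (τk + δ), ∀ x, ‖w (t + -τk) x‖ ≤ B := fun t ht x =>
    hwB _ (hpreb ⟨ht.1, by linarith [ht.2]⟩) x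
  have hE₁o : ∃ C : ℝ≥0∞, C < ⊤ ∧ ∀ t ∈ Icc τk (τk + δ), ∫⁻ x, ‖u₁ t x‖ₑ ^ 2 ≤ C := by
    obtain ⟨C, hC, hb⟩ := hE₁
    exact ⟨C, hC, fun t ht => hb t (hsubo ht)⟩
  have h0o : u₁ τk = w (τk + -τk) := by
    rw [(h₁s τk ⟨hτk0, le_rfl⟩).1, show τk + -τk = 0 by ring, hw0]
  have heqo : ∀ t ∈ Icc τk (τk + δ), u₁ t = w (t + -τk) :=
    velocity_eq_of_bounded_classical_Icc hν hτk0 (by linarith) S.force_smooth S.force_decay hwbo hEwb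
      hBwb h₁o hE₁o h0o
  have hagreeδ : ∀ σ ∈ Icc 0 δ, w σ = u₁ (σ + τk) := by
    intro σ hσ
    have h := heqo (σ + τk) ⟨by linarith [hσ.1], by linarith [hσ.2]⟩
    rw [h, show σ + τk + -τk = σ by ring]
  -- (3) the translate of `(u₁, p₁)` to `[0, δ]`; match the pressure gauge of `w` to it
  have hpret : Icc 0 δ ⊆ (fun σ => σ + τk) ⁻¹' Icc 0 T₁ := by
    intro σ hσ
    simp only [mem_preimage, mem_Icc] at hσ ⊢
    constructor <;> linarith [hσ.1, hσ.2]
  have hut : IsClassicalNSSolutionOn (Icc 0 δ) ν (fun σ => S.f (σ + S.τ k)) (fun σ => u₁ (σ + τk))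
      (fun σ => p₁ (σ + τk)) :=
    (h₁.comp_add_right τk).mono hpret (uniqueDiffOn_Icc hδ)
  obtain ⟨r', hw', hr'⟩ := hut.exists_pressure_eq_on_Icc hw hδ hδW hagreeδ
  -- (4) glue the re-gauged run (translated back) onto the local continuation, switching at `τ k + δ/2`
  have hwb0' : IsClassicalNSSolutionOn (Icc τk (τk + W)) ν
      (fun t => (fun σ => S.f (σ + S.τ k)) (t + -τk)) (fun t => w (t + -τk)) (fun t => r' (t + -τk)) :=
    (hw'.comp_add_right (-τk)).mono hpreb (uniqueDiffOn_Icc (by linarith))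
  have hwbf' : IsClassicalNSSolutionOn (Icc τk (τk + W)) ν S.f (fun t => w (t + -τk))
      (fun t => r' (t + -τk)) :=
    hwb0'.congr_force fun t _ x => by simp only [hτk, neg_add_cancel_right]
  have hov : ∀ t ∈ Ioo τk (τk + δ), u₁ t = w (t + -τk) ∧ p₁ t = r' (t + -τk) := by
    intro t ht
    have hσ : t + -τk ∈ Icc 0 δ := ⟨by linarith [ht.1], by linarith [ht.2]⟩
    refine ⟨heqo t ⟨ht.1.le, ht.2.le⟩, ?_⟩
    have hp := hr' (t + -τk) hσ
    rw [show t + -τk + τk = t by ring] at hp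
    exact hp.symm
  have hglue := h₁'.glue_Icc hwbf' hτk0 (show τk < τk + δ / 2 by linarith)
    (show τk + δ / 2 < τk + δ by linarith) (show τk + δ ≤ τk + W by linarith) hov
  refine ⟨_, _, hglue, ?_, ?_, ?_⟩
  · -- agreement with the stage on `[0, τ k]` (there the glued field is `(u₁, p₁)`)
    intro t ht
    have htm : t ≤ τk + δ / 2 := by linarith [ht.2]
    simp only [if_pos htm]
    exact h₁s t ht
  · -- finite energy: the larger of the two bounds
    obtain ⟨C₁, hC₁, hb₁⟩ := hE₁
    obtain ⟨C₂, hC₂, hb₂⟩ := hEw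
    refine ⟨max C₁ C₂, max_lt hC₁ hC₂, fun t ht => ?_⟩
    by_cases htm : t ≤ τk + δ / 2
    · simp only [if_pos htm]
      exact (hb₁ t ⟨ht.1, by linarith⟩).trans (le_max_left _ _)
    · simp only [if_neg htm]
      have hσ : t + -τk ∈ Icc 0 W := ⟨by rw [not_le] at htm; linarith, by linarith [ht.2]⟩
      exact (hb₂ (t + -τk) hσ).trans (le_max_right _ _)
  · -- the translate of the glued field is `w`
    intro σ hσ
    by_cases htm : σ + τk ≤ τk + δ / 2
    · simp only [if_pos htm]
      have hσδ : σ ∈ Icc 0 δ := ⟨hσ.1, by linarith⟩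
      exact (hagreeδ σ hσδ).symm
    · simp only [if_neg htm]
      show w (σ + τk + -τk) = w σ
      congr 1
      ring

/-- **Absolute-time form: a run on `[τ k, T]` under the design force from the slice IS a continuation.**
A classical solution `(v, q)` on `[τ k, T]`, `T > τ k`, of the design's own (forced) system with
`v (τ k) = s.u (τ k)`, of finite energy and bounded there, coincides on `[τ k, T]` with a classical
finite-energy continuation `(u, p)` of the stage `s` on `[0, T]` that agrees with `s` in velocity and
pressure on `[0, τ k]`. [cite: Sohr2001, Ch. V Thm. 1.5.1] [cite: Tao2011, Thm. 5.4 (ii)+(iv)] -/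
theorem exists_continuation_of_sliceRun (hν : 0 < ν) (s : Stage ν R S m k) {T : ℝ} (hT : S.τ k < T)
    {v : ℝ → EuclideanSpace ℝ (Fin 3) → EuclideanSpace ℝ (Fin 3)} {q : ℝ → EuclideanSpace ℝ (Fin 3) → ℝ}
    (hv : IsClassicalNSSolutionOn (Icc (S.τ k) T) ν S.f v q) (hv0 : v (S.τ k) = s.u (S.τ k))
    (hEv : ∃ C : ℝ≥0∞, C < ⊤ ∧ ∀ t ∈ Icc (S.τ k) T, ∫⁻ x, ‖v t x‖ₑ ^ 2 ≤ C)
    {B : ℝ} (hvB : ∀ t ∈ Icc (S.τ k) T, ∀ x, ‖v t x‖ ≤ B) :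
    ∃ (u : ℝ → EuclideanSpace ℝ (Fin 3) → EuclideanSpace ℝ (Fin 3)) (p : ℝ → EuclideanSpace ℝ (Fin 3) → ℝ),
      IsClassicalNSSolutionOn (Icc 0 T) ν S.f u p ∧
      (∀ t ∈ Icc 0 (S.τ k), u t = s.u t ∧ p t = s.p t) ∧
      (∃ C : ℝ≥0∞, C < ⊤ ∧ ∀ t ∈ Icc 0 T, ∫⁻ x, ‖u t x‖ₑ ^ 2 ≤ C) ∧
      ∀ t ∈ Icc (S.τ k) T, u t = v t := by
  set τk : ℝ := S.τ k with hτk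
  set W : ℝ := T - τk with hWdef
  have hW : 0 < W := by rw [hWdef]; linarith
  have hmem : ∀ σ ∈ Icc 0 W, σ + τk ∈ Icc τk T := fun σ hσ =>
    ⟨by linarith [hσ.1], by rw [hWdef] at hσ; linarith [hσ.2]⟩
  have hpre : Icc 0 W ⊆ (fun σ => σ + τk) ⁻¹' Icc τk T := fun σ hσ => hmem σ hσ
  have hw : IsClassicalNSSolutionOn (Icc 0 W) ν (fun σ => S.f (σ + S.τ k)) (fun σ => v (σ + τk))
      (fun σ => q (σ + τk)) :=
    (hv.comp_add_right τk).mono hpre (uniqueDiffOn_Icc hW)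
  have hw0 : (fun σ => v (σ + τk)) 0 = s.u (S.τ k) := by
    show v (0 + τk) = s.u (S.τ k)
    rw [zero_add, hτk, hv0]
  have hEw : ∃ C : ℝ≥0∞, C < ⊤ ∧ ∀ σ ∈ Icc 0 W, ∫⁻ x, ‖(fun σ => v (σ + τk)) σ x‖ₑ ^ 2 ≤ C := by
    obtain ⟨C, hC, hb⟩ := hEv
    exact ⟨C, hC, fun σ hσ => hb _ (hmem σ hσ)⟩
  have hwB : ∀ σ ∈ Icc 0 W, ∀ x, ‖(fun σ => v (σ + τk)) σ x‖ ≤ B := fun σ hσ x => hvB _ (hmem σ hσ) x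
  obtain ⟨u, p, hcl, hagree, hE, hshift⟩ := s.exists_continuation_of_windowRun hν hW hw hw0 hEw hwB
  have hT' : S.τ k + W = T := by rw [hWdef, hτk]; ring
  rw [hT'] at hcl hE
  refine ⟨u, p, hcl, hagree, hE, fun t ht => ?_⟩
  have hσ : t - τk ∈ Icc 0 W := ⟨by linarith [ht.1], by rw [hWdef]; linarith [ht.2]⟩
  have h := hshift (t - τk) hσ
  simp only [hτk, sub_add_cancel] at h
  exact h

/-! ## §2 … and with the next readouts it is a level witness / a registered stage one level up -/

/-- **A slice run carrying the next window ceiling and the three floors is a LEVEL WITNESS** (any rates,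
schedule, margin, `ν > 0`): restart AT `τ k` from `s.u (τ k)` under the design force, reach `τ (k+1)`
below `c₂ Y_{k+1}`, show at `τ (k+1)` in the ball the speed floor `c₁ Y_{k+1}`, the strain floor
`c₁ A_{k+1}` and the `N_{k+1}`-core loop ⟹ `S.LevelWitness ν k` (the glued continuation of §1 is the
witness; the ceiling on the window makes the run the bounded competitor). [cite: Sohr2001, Ch. V Thm. 1.5.1] -/
theorem levelWitness_of_sliceRun (hν : 0 < ν) (s : Stage ν R S m k)
    {v : ℝ → EuclideanSpace ℝ (Fin 3) → EuclideanSpace ℝ (Fin 3)} {q : ℝ → EuclideanSpace ℝ (Fin 3) → ℝ}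
    (hv : IsClassicalNSSolutionOn (Icc (S.τ k) (S.τ (k + 1))) ν S.f v q) (hv0 : v (S.τ k) = s.u (S.τ k))
    (hEv : ∃ C : ℝ≥0∞, C < ⊤ ∧ ∀ t ∈ Icc (S.τ k) (S.τ (k + 1)), ∫⁻ x, ‖v t x‖ₑ ^ 2 ≤ C)
    (hceil : ∀ t ∈ Icc (S.τ k) (S.τ (k + 1)), ∀ x, ‖v t x‖ ≤ S.c₂ * R.Y (k + 1))
    (hfloor : ∃ x, ‖x‖ ≤ S.radius ∧ S.c₁ * R.Y (k + 1) ≤ ‖v (S.τ (k + 1)) x‖)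
    (hstrain : ∃ x, ‖x‖ ≤ S.radius ∧ S.c₁ * R.A (k + 1) ≤ ‖fderiv ℝ (v (S.τ (k + 1))) x‖)
    (hcore : ∃ (x : EuclideanSpace ℝ (Fin 3)) (γ : ℝ → EuclideanSpace ℝ (Fin 3)),
      ‖x‖ ≤ S.radius ∧ ContDiff ℝ 1 γ ∧ γ 0 = γ 1 ∧
      (∀ σ ∈ Icc (0 : ℝ) 1, γ σ ∈ Metric.closedBall x (1 / R.N (k + 1))) ∧
      (∀ σ ∈ Icc (0 : ℝ) 1, ‖deriv γ σ‖ ≤ 8 * π / R.N (k + 1)) ∧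
      S.c₁ * R.N (k + 1) ^ (R.β - 2) ≤ circulation (v (S.τ (k + 1))) γ) :
    S.LevelWitness ν k := by
  obtain ⟨u, p, hcl, hagree, hE, hshift⟩ :=
    s.exists_continuation_of_sliceRun hν (S.τ_lt_succ k) hv hv0 hEv hceil
  have hlast : u (S.τ (k + 1)) = v (S.τ (k + 1)) :=
    hshift (S.τ (k + 1)) ⟨(S.τ_lt_succ k).le, le_rfl⟩
  refine ⟨u, p, hcl, ?_, hE, ?_, ?_, ?_, ?_⟩
  · rw [(hagree 0 ⟨le_rfl, (S.τ_pos k).le⟩).1, s.initial]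
  · intro t ht x
    rw [hshift t ht]
    exact hceil t ht x
  · rw [hlast]; exact hfloor
  · rw [hlast]; exact hstrain
  · rw [hlast]; exact hcore

/-- **THE EXACT-SLICE WINDOW FORM OF HEREDITY** (route margin, any rates, `ν > 0`; the `ε = 0` twin of
seat ecbridge-6's `Stage.exists_extends_of_window_solution`): a globally anchored registered stage at
level `k` plus ONE classical run on `[τ k, τ (k+1)]` under the design force FROM ITS SLICE `s.u (τ k)`,
finite energy, below `c₂ Y_{k+1}`, with the three level-`k+1` floors at `τ (k+1)`, IS extended by a
registered stage at level `k + 1`. [cite: Sohr2001, Ch. V Thm. 1.5.1] -/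
theorem exists_extends_of_sliceRun (hν : 0 < ν) (s : Stage ν R S (Margins.routeG R) k)
    {v : ℝ → EuclideanSpace ℝ (Fin 3) → EuclideanSpace ℝ (Fin 3)} {q : ℝ → EuclideanSpace ℝ (Fin 3) → ℝ}
    (hv : IsClassicalNSSolutionOn (Icc (S.τ k) (S.τ (k + 1))) ν S.f v q) (hv0 : v (S.τ k) = s.u (S.τ k))
    (hEv : ∃ C : ℝ≥0∞, C < ⊤ ∧ ∀ t ∈ Icc (S.τ k) (S.τ (k + 1)), ∫⁻ x, ‖v t x‖ₑ ^ 2 ≤ C)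
    (hceil : ∀ t ∈ Icc (S.τ k) (S.τ (k + 1)), ∀ x, ‖v t x‖ ≤ S.c₂ * R.Y (k + 1))
    (hfloor : ∃ x, ‖x‖ ≤ S.radius ∧ S.c₁ * R.Y (k + 1) ≤ ‖v (S.τ (k + 1)) x‖)
    (hstrain : ∃ x, ‖x‖ ≤ S.radius ∧ S.c₁ * R.A (k + 1) ≤ ‖fderiv ℝ (v (S.τ (k + 1))) x‖)
    (hcore : ∃ (x : EuclideanSpace ℝ (Fin 3)) (γ : ℝ → EuclideanSpace ℝ (Fin 3)),
      ‖x‖ ≤ S.radius ∧ ContDiff ℝ 1 γ ∧ γ 0 = γ 1 ∧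
      (∀ σ ∈ Icc (0 : ℝ) 1, γ σ ∈ Metric.closedBall x (1 / R.N (k + 1))) ∧
      (∀ σ ∈ Icc (0 : ℝ) 1, ‖deriv γ σ‖ ≤ 8 * π / R.N (k + 1)) ∧
      S.c₁ * R.N (k + 1) ^ (R.β - 2) ≤ circulation (v (S.τ (k + 1))) γ) :
    ∃ s' : Stage ν R S (Margins.routeG R) (k + 1), s.Extends s' :=
  s.nonempty_extends_of_levelWitness' hν
    (s.levelWitness_of_sliceRun hν hv hv0 hEv hceil hfloor hstrain hcore)

/-- **Converse: a stage one level up, read from `τ k` on, is a slice run** with all the readouts (any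
margin carrying the route margin's strain floors and core ledger: stated for `Margins.routeG`). [folklore] -/
theorem Extends.sliceRun {s : Stage ν R S (Margins.routeG R) k}
    {s' : Stage ν R S (Margins.routeG R) (k + 1)} (h : s.Extends s') :
    IsClassicalNSSolutionOn (Icc (S.τ k) (S.τ (k + 1))) ν S.f s'.u s'.p ∧
      s'.u (S.τ k) = s.u (S.τ k) ∧
      (∃ C : ℝ≥0∞, C < ⊤ ∧ ∀ t ∈ Icc (S.τ k) (S.τ (k + 1)), ∫⁻ x, ‖s'.u t x‖ₑ ^ 2 ≤ C) ∧
      (∀ t ∈ Icc (S.τ k) (S.τ (k + 1)), ∀ x, ‖s'.u t x‖ ≤ S.c₂ * R.Y (k + 1)) ∧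
      (∃ x, ‖x‖ ≤ S.radius ∧ S.c₁ * R.Y (k + 1) ≤ ‖s'.u (S.τ (k + 1)) x‖) ∧
      (∃ x, ‖x‖ ≤ S.radius ∧ S.c₁ * R.A (k + 1) ≤ ‖fderiv ℝ (s'.u (S.τ (k + 1))) x‖) ∧
      (∃ (x : EuclideanSpace ℝ (Fin 3)) (γ : ℝ → EuclideanSpace ℝ (Fin 3)),
        ‖x‖ ≤ S.radius ∧ ContDiff ℝ 1 γ ∧ γ 0 = γ 1 ∧
        (∀ σ ∈ Icc (0 : ℝ) 1, γ σ ∈ Metric.closedBall x (1 / R.N (k + 1))) ∧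
        (∀ σ ∈ Icc (0 : ℝ) 1, ‖deriv γ σ‖ ≤ 8 * π / R.N (k + 1)) ∧
        S.c₁ * R.N (k + 1) ^ (R.β - 2) ≤ circulation (s'.u (S.τ (k + 1))) γ) := by
  have hτk : 0 ≤ S.τ k := (S.τ_pos k).le
  refine ⟨?_, (h (S.τ k) ⟨hτk, le_rfl⟩).1, ?_, ?_, s'.floor (k + 1) le_rfl,
    s'.routeG_strain (k + 1) le_rfl, s'.routeG_coreLedger (k + 1) le_rfl⟩
  · exact s'.classical.mono (Icc_subset_Icc_left hτk) (uniqueDiffOn_Icc (S.τ_lt_succ k))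
  · obtain ⟨C, hC, hb⟩ := s'.energy
    exact ⟨C, hC, fun t ht => hb t ⟨hτk.trans ht.1, ht.2⟩⟩
  · intro t ht x
    exact s'.ceiling (k + 1) le_rfl t ⟨hτk.trans ht.1, ht.2⟩ x

end Stage

end Summit.NavierStokesRegularity.FluidComputer.PalasekTowerClayBridge

end
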